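import Summits.PneNP.PneNP.Theorems.SymmetryBudgetWindowBarrierEntropyGame

/-!
# Bijections along an equivalence relation ⟺ equal class counts (the counting form of a move)
(dichotomy `WindowBarrier` stmt-PneNP-2145 / `NoHiddenOrder` stmt-PneNP-14781, route `PneNP/SymmetryBudget`)

A move of the entropy game (`CosetGame.EntropyGame`, `CosetGame.Rel`) asks for a bijection `e` of a
finite group `A` with `f ρ ≈ g (e ρ)` for all `ρ`, where `f ρ`, `g ρ` are the sub-positions reached
through `ρ` on the two sides and `≈` is the previous round's equivalence.  A symmetric CIRCUIT cannot
guess `e`; it COUNTS.  This file is the dictionary (pure finite combinatorics, no circuits, no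
groups):

* `CosetGame.exists_equiv_iff_forall_card_eq`: for an equivalence relation `S` on any type `X`, maps
  `f g : α → X` from a finite type, (∃ `e : α ≃ α`, ∀ a, `S (f a) (g (e a))`) ↔ for every `b : α`,
  `#{a | S (f a) (g b)} = #{a | S (g a) (g b)}` — it suffices to compare the counts at the classes MET
  BY `g` (the classes of the fixed target side, which is what the completeness circuit hard-wires);
  the classes not met by `g` are then empty on the `f` side by a sum over the image.
* `CosetGame.card_filter_eq_of_exists_equiv`: conversely a bijection equalises the counts at EVERY
  point of `X`.
-/

-- `Summit.PneNP.PneNP.…` duplicates `PneNP` BY DESIGN (single-problem summit).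
set_option linter.dupNamespace false

namespace Summit.PneNP.PneNP.Theorems

open Finset

namespace CosetGame

variable {α X : Type*} [Fintype α]

/-- A bijection along `S` equalises the class counts at every point (reindex by `e`, then use that
`S (f a) x ↔ S (g (e a)) x`). -/
theorem card_filter_eq_of_exists_equiv (S : X → X → Prop) (hS : Equivalence S) (f g : α → X)
    (e : α ≃ α) (he : ∀ a, S (f a) (g (e a))) (x : X)
    [DecidablePred fun a => S (f a) x] [DecidablePred fun a => S (g a) x] :
    (univ.filter fun a => S (f a) x).card = (univ.filter fun a => S (g a) x).card := by
  refine Finset.card_bij (fun a _ => e a) (fun a ha => ?_) (fun a _ b _ h => e.injective h)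
    (fun b hb => ⟨e.symm b, ?_, e.apply_symm_apply b⟩)
  · simp only [mem_filter, mem_univ, true_and] at ha ⊢
    exact hS.trans (hS.symm (he a)) ha
  · simp only [mem_filter, mem_univ, true_and] at hb ⊢
    have h := he (e.symm b)
    rw [e.apply_symm_apply] at h
    exact hS.trans h hb

/-- **Counting form of a move.**  For an equivalence relation `S` on `X` and `f g : α → X` (`α`
finite): a bijection `e` of `α` with `f a ≈ g (e a)` for all `a` exists iff for every `b` the number
of `a` with `f a ≈ g b` equals the number of `a` with `g a ≈ g b`.  (⇐: pass to the quotient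
`X/S`; the `f`-fibres over classes not met by `g` are empty because the fibres over the classes met
by `g` already exhaust `α`; glue fibrewise bijections with `Equiv.sigmaFiberEquiv`.) -/
theorem exists_equiv_iff_forall_card_eq (S : X → X → Prop) (hS : Equivalence S) (f g : α → X)
    [∀ a b, Decidable (S (f a) (g b))] [∀ a b, Decidable (S (g a) (g b))] :
    (∃ e : α ≃ α, ∀ a, S (f a) (g (e a))) ↔
      ∀ b : α, (univ.filter fun a => S (f a) (g b)).card = (univ.filter fun a => S (g a) (g b)).card := by
  classical
  constructor
  · rintro ⟨e, he⟩ b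
    convert card_filter_eq_of_exists_equiv S hS f g e he (g b)
  · intro h
    -- pass to the quotient by `S`
    let s : Setoid X := ⟨S, hS⟩
    let f' : α → Quotient s := fun a => Quotient.mk s (f a)
    let g' : α → Quotient s := fun a => Quotient.mk s (g a)
    -- fibre counts agree over the classes met by `g` …
    have hmet : ∀ b : α, (univ.filter fun a => f' a = g' b).card = (univ.filter fun a => g' a = g' b).card := by
      intro b
      have e1 : (univ.filter fun a => f' a = g' b) = univ.filter fun a => S (f a) (g b) := by
        ext a
        simp only [mem_filter, mem_univ, true_and]
        exact ⟨fun hy => Quotient.exact hy, fun hy => Quotient.sound hy⟩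
      have e2 : (univ.filter fun a => g' a = g' b) = univ.filter fun a => S (g a) (g b) := by
        ext a
        simp only [mem_filter, mem_univ, true_and]
        exact ⟨fun hy => Quotient.exact hy, fun hy => Quotient.sound hy⟩
      rw [e1, e2]
      exact h b
    -- … hence everywhere: the `f`-fibres over the other classes are empty
    have hall : ∀ y : Quotient s,
        (univ.filter fun a => f' a = y).card = (univ.filter fun a => g' a = y).card := by
      intro y
      by_cases hy : y ∈ univ.image g'
      · obtain ⟨b, -, rfl⟩ := mem_image.1 hy
        exact hmet b
      · have hg0 : (univ.filter fun a => g' a = y).card = 0 := by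
          rw [Finset.card_eq_zero, Finset.filter_eq_empty_iff]
          intro a _ hay
          exact hy (mem_image.2 ⟨a, mem_univ a, hay⟩)
        rw [hg0, Finset.card_eq_zero, Finset.filter_eq_empty_iff]
        intro a _ hay
        -- the fibres of `f'` over `image g'` already exhaust `α`
        have hsum : (univ : Finset α).card =
            ∑ y ∈ univ.image g', (univ.filter fun a : α => f' a = y).card := by
          calc (univ : Finset α).card
              = ∑ y ∈ univ.image g', (univ.filter fun a : α => g' a = y).card :=
                Finset.card_eq_sum_card_fiberwise fun a _ => mem_image_of_mem g' (mem_univ a)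
            _ = ∑ y ∈ univ.image g', (univ.filter fun a : α => f' a = y).card := by
                refine Finset.sum_congr rfl fun y hy' => ?_
                obtain ⟨b, -, rfl⟩ := mem_image.1 hy'
                exact (hmet b).symm
        -- so every `a` lies in one of them
        have hcover : (univ : Finset α) ⊆
            (univ.image g').biUnion fun y => univ.filter fun a : α => f' a = y := by
          have hdisj : ((univ.image g' : Finset (Quotient s)) : Set (Quotient s)).PairwiseDisjoint
              fun y => univ.filter fun a : α => f' a = y := by
            intro y _ y' _ hyy'
            simp only [Function.onFun]
            rw [Finset.disjoint_filter]
            intro a _ hay hay'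
            exact hyy' (hay.symm.trans hay')
          have hcard : ((univ.image g').biUnion fun y => univ.filter fun a : α => f' a = y).card =
              (univ : Finset α).card := by
            rw [Finset.card_biUnion hdisj, ← hsum]
          exact (Finset.eq_of_subset_of_card_le (Finset.subset_univ _) hcard.ge).symm.subset
        have ha := hcover (mem_univ a)
        simp only [mem_biUnion, mem_filter, mem_univ, true_and] at ha
        obtain ⟨y', hy', hay'⟩ := ha
        exact hy (hay ▸ hay' ▸ hy')
    -- glue fibrewise bijections
    have hcard : ∀ y : Quotient s, Fintype.card {a // f' a = y} = Fintype.card {a // g' a = y} := by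
      intro y
      rw [Fintype.card_subtype, Fintype.card_subtype]
      exact hall y
    let φ : ∀ y : Quotient s, {a // f' a = y} ≃ {a // g' a = y} := fun y => Fintype.equivOfCardEq (hcard y)
    refine ⟨(Equiv.sigmaFiberEquiv f').symm.trans ((Equiv.sigmaCongrRight φ).trans (Equiv.sigmaFiberEquiv g')),
      fun a => ?_⟩
    have hga : g' ((Equiv.sigmaFiberEquiv g') ⟨f' a, φ (f' a) ⟨a, rfl⟩⟩) = f' a :=
      (φ (f' a) ⟨a, rfl⟩).2
    have : S (g ((Equiv.sigmaFiberEquiv g') ⟨f' a, φ (f' a) ⟨a, rfl⟩⟩)) (f a) := Quotient.exact hga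
    exact hS.symm this

end CosetGame

end Summit.PneNP.PneNP.Theorems
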